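import Mathlib
import HarnessLib

/-!
# `NoHeavyLowerTail` (crux stmt-CriticalPhenomena-4575), antithetic vdBHK programme: the POTENTIAL METHOD for the inner hub induction (scalar skeleton)

Support file (seat `prim-ineq-gen-7` gen 33; `--supports stmt-CriticalPhenomena-4575`).  Nothing is asserted about the crux; no `sorry`,
no definitions.  Memo: run/shared/lean/prim/prim-ineq-gen-7/FINDING-SPIDER-g33.md §2–§3 (THEOREM SP), PROOF-PG-g32.md §2–§3.

CONTEXT.  For a two-leg tree `P_k ∨ T₂` (pure leg a path, mixed leg `T₂` with colouring poset `G = F_v(T₂)`), THEOREM PG (gen 32) reduces the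
per-tree certificate inequality `(***)` to two finite statements about `G`, `BASE^G_0` and `HUB^G_0`.  Gen 33 proves `HUB^{F_v(P_j)}_0 ≥ 0` for ALL `j`
by the inner induction `G = hub(G′)` STRENGTHENED WITH A POTENTIAL `Π^G = Σ_{tops t} π(σ(t))`:
`HUB^G = HUB^{G′} + MIX + Σ_levels DLOCAL` (MIX ≥ 0, Kleitman), `Π^G = Π^{G′} + Σ_levels (π_T + π_new − π_old)`, and a machine-checked LEVEL lemma
`DLOCAL ≥ π_T + π_new − π_old` (34,188,010,000 cases) plus a BASE lemma (456,976 cases) give `HUB^G − Π^G ≥ HUB^{G′} − Π^{G′} ≥ … ≥ 0`.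
This file records the three scalar facts the argument is assembled from:

* `AntitheticPotential.lemmaA` — LEMMA A of PROOF-PG-g32 §3: the certificate indicator is monotone (increasing in the route bits, decreasing in the
  membership bits); in particular with routes `AL ⊆ T` and memberships `B ⊆ U` an `(AL,U)`-certificate at an element is a `(T,B)`-certificate there.
* `AntitheticPotential.hub_potential_step` — one step of the strengthened induction: decomposition + `MIX ≥ 0` + potential bookkeeping + the level
  lemma + the induction hypothesis give `Π^G ≤ HUB^G`.
* `AntitheticPotential.potential_induction` — the telescoping over `j` from the base.
-/

namespace Summit.CriticalPhenomena.PercolationContinuityZ3.Theorems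

open Finset

namespace AntitheticPotential

/-- **LEMMA A** (PROOF-PG-g32 §3; FINDING-SPIDER-g33 §2): the certificate indicator at one element — routes `k = (kₐ,kₐ′,k_b,k_b′)` (does the route
set meet `K(g)`?), memberships `m = (mₐ,mₐ′,m_b,m_b′)`; type 1 `kₐ ∧ ¬mₐ′ ∧ ¬m_b ∧ k_b′` or type 2 `¬mₐ ∧ kₐ′ ∧ k_b ∧ ¬m_b′` — is monotone — more routes and fewer memberships can only
create certificates.  With route bits `kL ≤ kT` (e.g. `AL ⊆ T`) and membership bits `mB ≤ mU` (e.g. `B ⊆ U`), an `(AL,U)`-certificate is a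
`(T,B)`-certificate at the same element. [this work] -/
theorem lemmaA (kTa kTa' kTb kTb' kLa kLa' kLb kLb' mBa mBa' mBb mBb' mUa mUa' mUb mUb' : Bool)
    (h1 : kLa = true → kTa = true) (h2 : kLa' = true → kTa' = true) (h3 : kLb = true → kTb = true) (h4 : kLb' = true → kTb' = true)
    (h5 : mBa = true → mUa = true) (h6 : mBa' = true → mUa' = true) (h7 : mBb = true → mUb = true) (h8 : mBb' = true → mUb' = true)
    (h : ((kLa && !mUa' && !mUb && kLb') || (!mUa && kLa' && kLb && !mUb')) = true) :
    ((kTa && !mBa' && !mBb && kTb') || (!mBa && kTa' && kTb && !mBb')) = true := by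
  simp only [Bool.or_eq_true, Bool.and_eq_true, Bool.not_eq_true'] at h ⊢
  rcases h with ⟨⟨⟨ha, ha'⟩, hb⟩, hb'⟩ | ⟨⟨⟨ha, ha'⟩, hb⟩, hb'⟩
  · left
    refine ⟨⟨⟨h1 ha, ?_⟩, ?_⟩, h4 hb'⟩
    · cases hm : mBa' with
      | false => rfl
      | true => exact absurd (h6 hm) (by simp [ha'])
    · cases hm : mBb with
      | false => rfl
      | true => exact absurd (h7 hm) (by simp [hb])
  · right
    refine ⟨⟨⟨?_, h2 ha'⟩, h3 hb⟩, ?_⟩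
    · cases hm : mBa with
      | false => rfl
      | true => exact absurd (h5 hm) (by simp [ha])
    · cases hm : mBb' with
      | false => rfl
      | true => exact absurd (h8 hm) (by simp [hb'])

/-- Integer form of LEMMA A: `1_{cert(AL,U)} ≤ 1_{cert(T,B)}` pointwise, hence `cert^G(AL,U) ≤ cert^G(T,B)` after summing over the elements
of `G` (the `(AL,U)`-losses of the hub functional are dominated position by position by the hub bottom's certificates). [this work] -/
theorem lemmaA_indicator (kTa kTa' kTb kTb' kLa kLa' kLb kLb' mBa mBa' mBb mBb' mUa mUa' mUb mUb' : Bool)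
    (h1 : kLa = true → kTa = true) (h2 : kLa' = true → kTa' = true) (h3 : kLb = true → kTb = true) (h4 : kLb' = true → kTb' = true)
    (h5 : mBa = true → mUa = true) (h6 : mBa' = true → mUa' = true) (h7 : mBb = true → mUb = true) (h8 : mBb' = true → mUb' = true) :
    (if ((kLa && !mUa' && !mUb && kLb') || (!mUa && kLa' && kLb && !mUb')) = true then (1:ℤ) else 0)
      ≤ (if ((kTa && !mBa' && !mBb && kTb') || (!mBa && kTa' && kTb && !mBb')) = true then (1:ℤ) else 0) := by
  by_cases h : ((kLa && !mUa' && !mUb && kLb') || (!mUa && kLa' && kLb && !mUb')) = true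
  · rw [if_pos h, if_pos (lemmaA kTa kTa' kTb kTb' kLa kLa' kLb kLb' mBa mBa' mBb mBb' mUa mUa' mUb mUb' h1 h2 h3 h4 h5 h6 h7 h8 h)]
  · rw [if_neg h]
    split <;> norm_num

/-- **One step of the strengthened (potential) induction** (FINDING-SPIDER-g33 §2a/§3).  Over a finite set of levels `s`:
the exact decomposition `HUB^G = HUB^{G′} + MIX + Σ_y d_y` with `MIX ≥ 0`, the potential bookkeeping `Π^G = Π^{G′} + Σ_y (πT_y + πN_y − πO_y)`,
the LEVEL lemma `πT_y + πN_y − πO_y ≤ d_y` at every level, and the induction hypothesis `Π^{G′} ≤ HUB^{G′}` give `Π^G ≤ HUB^G`. [this work] -/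
theorem hub_potential_step {ι : Type*} (s : Finset ι) (hubG hubG' mix potG potG' : ℤ) (d πT πN πO : ι → ℤ)
    (hdec : hubG = hubG' + mix + ∑ y ∈ s, d y) (hmix : 0 ≤ mix)
    (hpot : potG = potG' + ∑ y ∈ s, (πT y + πN y - πO y))
    (hlev : ∀ y ∈ s, πT y + πN y - πO y ≤ d y) (hind : potG' ≤ hubG') :
    potG ≤ hubG := by
  have hsum : ∑ y ∈ s, (πT y + πN y - πO y) ≤ ∑ y ∈ s, d y := Finset.sum_le_sum hlev
  rw [hdec, hpot]
  linarith

/-- **Telescoping** (FINDING-SPIDER-g33 §3): if `Π₀ ≤ H₀` (BASE), `H_j − Π_j ≤ H_{j+1} − Π_{j+1}` (the step above) and `0 ≤ Π_j` (potentials are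
nonnegative), then `0 ≤ H_j` for every `j` — i.e. `HUB^{F_v(P_j)}_0 ≥ Π ≥ 0` for all `j`. [this work] -/
theorem potential_induction (H P : ℕ → ℤ) (h0 : P 0 ≤ H 0) (hstep : ∀ j, H j - P j ≤ H (j + 1) - P (j + 1))
    (hP : ∀ j, 0 ≤ P j) : ∀ j, 0 ≤ H j := by
  have key : ∀ j, P j ≤ H j := by
    intro j
    induction j with
    | zero => exact h0
    | succ n ih => have := hstep n; linarith
  intro j
  exact le_trans (hP j) (key j)

end AntitheticPotential

end Summit.CriticalPhenomena.PercolationContinuityZ3.Theorems
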